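import Summits.QuantumFields.YangMills.Theorems.BalabanUVNodesK0RecordFormatNamesFluctQtC
import Summits.QuantumFields.YangMills.Theorems.BalabanUVNodesPortS1JacobianHoloDomainDet
import Literature.MathematicalPhysics.QuantumFieldTheory.Balaban1983to89.B15AveragingHolomorphicLocal
import Literature.MathematicalPhysics.QuantumFieldTheory.Balaban1983to89.B7TransferAnalyticMean

/-!
# NODE O port PT-A — socket (o1) «D̃» of DEF-1's stage 2, leaf (o1-β)₁: ALGEBRA AND ℂ-DIFFERENTIABILITY OF ★★ DEF-1's COMPLEXIFIED CONSTRAINT `recordQtC` (✓`…K0RecordFormatNamesFluctQtC`, (o1-α),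
# p827120) — `z ↦ log( M_h(exp(Σ_a z(b,a)·iσ_a)·V^{(k)})(c) · Ū(V^{(k)})(c)⋆ )` is ℂ-differentiable wherever the (0.4) loop matrices of the complex field `pertC Vk z` lie in the polydisc `‖W − 1‖ < 1`
# and the quotient in the series-log window (the qualitative half of lit's `B13Contraction113.QuadAnalytic` for `C̃ = recordCtC`; [I] p.267 «it is an analytic function of B»)

Cell `ym-nodeO-ideate`, porter seat `ymgap-nodeO-port-PTA-1` (gen 9); `--kind proof --supports stmt-QuantumFields-27930 --as helper` (FIBRE-CHART-LAW-v1 row (L3-c) ∕ bus l.5715 «(o1) at the record =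
lit r09 g11's ✓`B12LinearizationGenuineZd` chain RE-RUN over ✓`B15AveragingHolomorphic`»; ★★ DEF-1 g39 15:26:19Z «(o1-β) starts against THESE names»; ◆ CRIT-1 g39 rider (R-k): identifications as BRIDGE
theorems, never second objects — the derivative bridges `recordLQtC ∘ ofReal = ↑recordLQt` and the `jacBlockC` block identification are leaf (o1-β)₂).  [I] = [Balaban1987RG1]; [15] = [Balaban1985Variational].

CONTENT (theorems only; no `def`, no `instance`, no `sorry`): §1 algebra of DEF-1's `fluctMatC`∕`pertC` — `trace_fluctMatC` (`= 0`), `det_exp_fluctMatC` (`= 1`, Liouville ✓`Literature.Analysis.Matrix.det_exp_eq_exp_trace`),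
`det_pertC` (`= 1`), `pertC_mul_star` (`pertC Vk z b · (↑Vk b)⋆ = exp(fluctMatC z b)`), `norm_fluctMatC_le` (`≤ 3‖z‖`, ✓`norm_su2Gen`), ★ `norm_pertC_mul_star_sub_one_le` (`≤ e^{3‖z‖} − 1` — the `s` of PT-B's
✓`C44IterMh.norm_loopMh_sub_one_le` ∕ `exists_regauge`); §2 ℂ-differentiability — `differentiable_fluctMatC`, ★ `differentiable_pertC` (entire; Mathlib `NormedSpace.exp_analytic`), ★★
`differentiableAt_recordQtC` ∕ `differentiableAt_recordQtC_pi` ∕ `differentiableOn_recordQtC` (✓`B15AveragingHolomorphicLocal.differentiableAt_avgMh_apply` + ✓`MatrixLog.analyticAt_mlog`).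

HONEST FRAMING.  Composition-of-analytic-maps bookkeeping over DEF-1's definitions; the QUANTITATIVE half (a k-uniform polydisc radius from PT-B's one-step loop estimates, the sup bound, `QuadAnalytic recordCtC`,
`exists_Dt`) and ◆'s (R-k) bridges are the next leaves; nothing of Bałaban's estimates asserted, ported or discharged; `stub_P0C` ∕ `stub_FE` OPEN; ⟨27930⟩ ⁸-Ax-LR4 OPEN · no claim; NODE O 0∕1; COUNT
8∕28 · K 1∕4 UNMOVED; finite `𝕋⁴_{L^K}` at fixed ε — NOT continuum ∕ OS ∕ Clay; **the Yang–Mills mass gap is NOT proved by any of this.**  Standard axioms.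
-/

noncomputable section

open scoped BigOperators Matrix.Norms.L2Operator

namespace Summit.QuantumFields.YangMills.Theorems.BalabanUVNodesPortS1

open Literature.MathematicalPhysics.QuantumFieldTheory.Balaban1983to89
open Literature.MathematicalPhysics.QuantumFieldTheory.Balaban1983to89.Node00
open Literature.MathematicalPhysics.QuantumFieldTheory.Balaban1983to89.T4Continuum (T4Family)
open Literature.MathematicalPhysics.QuantumFieldTheory.Balaban1983to89.B15AveragingHolomorphic (avgMh loopMh)
open Literature.MathematicalPhysics.QuantumFieldTheory.Balaban1983to89.B15AveragingHolomorphicLocal (differentiableAt_avgMh_apply)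
open Summit.QuantumFields.YangMills.Theorems.K0RecordFormatNames (su2Gen FluctIdx fluctMatC pertC recordQtC recordQtC_apply)
open NormedSpace (exp)

variable (F : T4Family)

/-! ## §1  Algebra of the complexified chart -/

/-- `tr (Σ_a z_a iσ_a) = 0`. [folklore] -/
theorem trace_fluctMatC (k K : ℕ) (z : FluctIdx F k K → ℂ) (b : PBond (F.P K) k) : (fluctMatC F k K z b).trace = 0 := by
  rw [fluctMatC, Matrix.trace_sum]
  exact Finset.sum_eq_zero fun a _ => by rw [Matrix.trace_smul, trace_su2Gen, smul_zero]

/-- `det exp(Σ_a z_a iσ_a) = 1` (Liouville `det exp = exp tr`). [folklore] -/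
theorem det_exp_fluctMatC (k K : ℕ) (z : FluctIdx F k K → ℂ) (b : PBond (F.P K) k) : (exp (fluctMatC F k K z b)).det = 1 := by
  rw [Literature.Analysis.Matrix.det_exp_eq_exp_trace, trace_fluctMatC, NormedSpace.exp_zero]

/-- The complex chart has determinant one at every bond (print's `Gᶜ = SL(2,ℂ)`-valued field). [cite: Balaban1985Variational, p.307] -/
theorem det_pertC (k K : ℕ) (Vk : GaugeField (F.P K) k (SU 2)) (z : FluctIdx F k K → ℂ) (b : PBond (F.P K) k) : (pertC F k K Vk z b).det = 1 := by
  rw [pertC, Matrix.det_mul, det_exp_fluctMatC, one_mul]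
  exact (Vk b).2.2

/-- `(exp X_b · V^{(k)}(b)) · V^{(k)}(b)⋆ = exp X_b` (`V^{(k)}(b)` unitary). [folklore] -/
theorem pertC_mul_star (k K : ℕ) (Vk : GaugeField (F.P K) k (SU 2)) (z : FluctIdx F k K → ℂ) (b : PBond (F.P K) k) :
    pertC F k K Vk z b * star (Vk b : MatA 2) = exp (fluctMatC F k K z b) := by
  rw [pertC, mul_assoc, Matrix.mem_unitaryGroup_iff.1 (Vk b).2.1, mul_one]

/-- `‖Σ_a z(b,a) iσ_a‖ ≤ 3‖z‖` (`‖iσ_a‖ = 1`, sup norm on `z`). [folklore] -/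
theorem norm_fluctMatC_le (k K : ℕ) (z : FluctIdx F k K → ℂ) (b : PBond (F.P K) k) : ‖fluctMatC F k K z b‖ ≤ 3 * ‖z‖ := by
  rw [fluctMatC]
  calc ‖∑ a, z (b, a) • su2Gen a‖ ≤ ∑ a : Fin 3, ‖z (b, a) • su2Gen a‖ := norm_sum_le _ _
    _ ≤ ∑ _a : Fin 3, ‖z‖ := Finset.sum_le_sum fun a _ => by
        rw [norm_smul, norm_su2Gen, mul_one]
        exact norm_le_pi_norm z (b, a)
    _ = 3 * ‖z‖ := by rw [Finset.sum_const, Finset.card_univ, Fintype.card_fin]; ring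

/-- ★ `‖exp X_b · V^{(k)}(b) · V^{(k)}(b)⋆ − 1‖ ≤ e^{3‖z‖} − 1` — the `s` of PT-B's one-step loop estimates (✓`C44IterMh.norm_loopMh_sub_one_le`, `exists_regauge`). [cite: Balaban1985Averaging, (24) p.21] -/
theorem norm_pertC_mul_star_sub_one_le (k K : ℕ) (Vk : GaugeField (F.P K) k (SU 2)) (z : FluctIdx F k K → ℂ) (b : PBond (F.P K) k) :
    ‖pertC F k K Vk z b * star (Vk b : MatA 2) - 1‖ ≤ Real.exp (3 * ‖z‖) - 1 := by
  rw [pertC_mul_star]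
  exact (B7TransferAnalyticMean.norm_exp_sub_one_le _).trans (by
    have := Real.exp_le_exp.2 (norm_fluctMatC_le F k K z b)
    linarith)

/-! ## §2  ℂ-differentiability -/

/-- `z ↦ fluctMatC z b` is ℂ-linear, hence ℂ-differentiable. [folklore] -/
theorem differentiable_fluctMatC (k K : ℕ) (b : PBond (F.P K) k) : Differentiable ℂ fun z : FluctIdx F k K → ℂ => fluctMatC F k K z b := by
  unfold fluctMatC
  refine Differentiable.fun_sum fun a _ => ?_
  exact ((ContinuousLinearMap.proj (R := ℂ) (φ := fun _ : FluctIdx F k K => ℂ) (b, a)).differentiable).smul_const (su2Gen a)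

/-- ★ `z ↦ pertC Vk z` is ℂ-differentiable everywhere (entire `exp`, Mathlib `NormedSpace.exp_analytic`). [cite: Balaban1985Variational, p.307 («Gᶜ-valued fields»)] -/
theorem differentiable_pertC (k K : ℕ) (Vk : GaugeField (F.P K) k (SU 2)) : Differentiable ℂ (pertC F k K Vk) := by
  refine differentiable_pi.2 fun b => ?_
  have hexp : Differentiable ℂ fun z : FluctIdx F k K → ℂ => exp (fluctMatC F k K z b) := fun z =>
    (NormedSpace.exp_analytic (𝕂 := ℂ) (fluctMatC F k K z b)).differentiableAt.comp z (differentiable_fluctMatC F k K b z)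
  exact hexp.mul_const _

/-- ★★ **`Q̃_ℂ(V^{(k)}; ·)(c)` IS ℂ-DIFFERENTIABLE at every `z₀` whose complex field has its (0.4) loop matrices at `c` in the polydisc `‖W − 1‖ < 1` and whose quotient `M_h(Ṽ)(c)·Ū(V^{(k)})(c)⋆` is in the
series-log window** (`pertC` entire ∘ ✓`differentiableAt_avgMh_apply` ∘ right multiplication ∘ ✓`MatrixLog.analyticAt_mlog`). [cite: Balaban1987RG1, p.267 («it is an analytic function of B»); Balaban1985Variational, Prop. 9 p.309] -/
theorem differentiableAt_recordQtC (k K : ℕ) (Vk : GaugeField (F.P K) k (SU 2)) (c : PBond (F.P K) (k + 1)) (z₀ : FluctIdx F k K → ℂ)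
    (hloop : ∀ i : BlockAveraging.Idx (F.P K), ‖loopMh (pertC F k K Vk z₀) c i - 1‖ < 1)
    (hlog : ‖avgMh (pertC F k K Vk z₀) c * star (((avOfRecord F 2 K k).avg Vk c : SU 2) : MatA 2) - 1‖ < 1) :
    DifferentiableAt ℂ (fun z => recordQtC F k K Vk z c) z₀ := by
  have havg : DifferentiableAt ℂ (fun z => avgMh (pertC F k K Vk z) c) z₀ :=
    (differentiableAt_avgMh_apply c hloop).comp z₀ (differentiable_pertC F k K Vk z₀)
  have hquot : DifferentiableAt ℂ (fun z => avgMh (pertC F k K Vk z) c * star (((avOfRecord F 2 K k).avg Vk c : SU 2) : MatA 2)) z₀ := havg.mul_const _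
  exact (MatrixLog.analyticAt_mlog hlog).differentiableAt.comp z₀ hquot

/-- The same for the whole coarse-bond family (`Pi` codomain). [cite: Balaban1987RG1, p.267] -/
theorem differentiableAt_recordQtC_pi (k K : ℕ) (Vk : GaugeField (F.P K) k (SU 2)) (z₀ : FluctIdx F k K → ℂ)
    (hloop : ∀ (c : PBond (F.P K) (k + 1)) (i : BlockAveraging.Idx (F.P K)), ‖loopMh (pertC F k K Vk z₀) c i - 1‖ < 1)
    (hlog : ∀ c : PBond (F.P K) (k + 1), ‖avgMh (pertC F k K Vk z₀) c * star (((avOfRecord F 2 K k).avg Vk c : SU 2) : MatA 2) - 1‖ < 1) :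
    DifferentiableAt ℂ (recordQtC F k K Vk) z₀ :=
  differentiableAt_pi.2 fun c => differentiableAt_recordQtC F k K Vk c z₀ (hloop c) (hlog c)

/-- On any set where both windows hold, `Q̃_ℂ(V^{(k)}; ·)` is ℂ-differentiable ON the set — the `DifferentiableOn ℂ Qt (ball 0 R)` input of ✓`LinearizingChange267FromQ.nonlin_sq_bound` ∕
✓`ShellMeasureLandauFixedPoint.quadAnalytic_of_frechet` (the quantitative radius is the next leaf). [cite: Balaban1987RG1, p.267] -/
theorem differentiableOn_recordQtC (k K : ℕ) (Vk : GaugeField (F.P K) k (SU 2)) {U : Set (FluctIdx F k K → ℂ)}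
    (hloop : ∀ z₀ ∈ U, ∀ (c : PBond (F.P K) (k + 1)) (i : BlockAveraging.Idx (F.P K)), ‖loopMh (pertC F k K Vk z₀) c i - 1‖ < 1)
    (hlog : ∀ z₀ ∈ U, ∀ c : PBond (F.P K) (k + 1), ‖avgMh (pertC F k K Vk z₀) c * star (((avOfRecord F 2 K k).avg Vk c : SU 2) : MatA 2) - 1‖ < 1) :
    DifferentiableOn ℂ (recordQtC F k K Vk) U := fun z hz =>
  (differentiableAt_recordQtC_pi F k K Vk z (hloop z hz) (hlog z hz)).differentiableWithinAt

end Summit.QuantumFields.YangMills.Theorems.BalabanUVNodesPortS1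

end
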